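import Mathlib
import HarnessLib
import Summits.AtomisticToContinuum.Crystallization.Theorems.OverbindingBudgetShellHoleFacets
import Summits.AtomisticToContinuum.Crystallization.Theorems.PricedLinkCensusSoftFourRingsCapCertD8Check
import Summits.AtomisticToContinuum.Crystallization.Theorems.PricedLinkCensusSoftFourRingsBridge
import Summits.AtomisticToContinuum.Crystallization.Theorems.OverbindingBudgetGapFreeShellHole

/-!
# Shell-hole cover III — `ShellHoleBound (21/32)` and `GapFreeShells`

We prove `OverbindingBudgetGapFreeShellHole.ShellHoleBound (21/32)`: around a charge-free site
`i` of an injective configuration at tolerance `η = 1/100`, every direction `u` makes an angle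
of cosine `≥ 21/32` with some bond `y k − y i` (`shellHoleBound_holds`).  With the proved seam
`gapFreeShells_of_shellHoleBound_fortyNine` this yields
`OverbindingBudgetMisfitCensusStatements.GapFreeShells` (`gapFreeShells_holds`).

Proof.  Normalise the twelve bonded neighbours of `i` to the hull setting of the
`PricedLinkCensus` chain (`hull_setting_of_twelve`).  By `Cap.bondToCap_holds` the covering
radius of `X` is `< 0.957`, so `0 ∈ interior (conv X)` and a unit vector `p` lies in the cone
over some facet (`argmaxCone_facetNormals_eq`): `p = t q`, `q ∈ conv (tight set)`, `⟪c, q⟫ = 1`,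
whence `‖q‖ ≥ ‖c‖⁻¹ ≥ √c_b ≥ 11/16` by the facet level bound (file II), and some tight vertex
`x` has `⟪x, q⟫ ≥ ‖q‖²` (maximum of the linear map `⟪q, ·⟫` on a hull), i.e. `⟪x, p⟫ ≥ 11/16`
(`hull_cover`).  Undoing the normalisation, `x` is within `1/100` of a normalised bond vector
`z_j` with `‖z_j‖ ≤ 1.01`, so `⟪z_j, p⟫ ≥ 11/16 − 1/100 ≥ (21/32)·1.01 ≥ (21/32) ‖z_j‖`.
-/

namespace Summit.AtomisticToContinuum.Crystallization.Theorems.OverbindingBudgetShellHoleCover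

open Real RealInnerProductSpace Literature.Geometry.DiscreteGeometry OverbindingBudgetShellHoleFacets

/-! ## The hole lemma and the cover of the hull setting -/

/-- **Cover of the hull setting.**  In the hull setting of the twelve-point reduction every
unit vector is within `arccos (11/16) < 46.6°` of one of the twelve directions. -/
theorem hull_cover {X : Finset (EuclideanSpace ℝ (Fin 3))} {B : Finset (Finset (EuclideanSpace ℝ (Fin 3)))}
    (hX1 : ∀ y ∈ X, ‖y‖ = 1) (hcard : X.card = 12)
    (hsepX : ∀ u ∈ X, ∀ u' ∈ X, u ≠ u' → ⟪u, u'⟫ ≤ 1 - 1 / (2 * (101 / 100 : ℝ) ^ 2))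
    (hB : ∀ T ∈ B, ∃ u ∈ X, ∃ u' ∈ X, u ≠ u' ∧ 1 - (101 / 100 : ℝ) ^ 2 / 2 ≤ ⟪u, u'⟫ ∧
      T = {u, u'})
    (hBcard : B.card = 24)
    (hdeg : ∀ v ∈ X, ∃ w : Fin 4 → EuclideanSpace ℝ (Fin 3), (∀ k, w k ∈ X) ∧ Function.Injective w ∧
      (∀ k, w k ≠ v) ∧ (∀ k, ({v, w k} : Finset (EuclideanSpace ℝ (Fin 3))) ∈ B) ∧
      ∀ y, ({v, y} : Finset (EuclideanSpace ℝ (Fin 3))) ∈ B → ∃ k, y = w k)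
    (hnb : ∀ u ∈ X, ∀ u' ∈ X, u ≠ u' → ({u, u'} : Finset (EuclideanSpace ℝ (Fin 3))) ∉ B → ⟪u, u'⟫ < 101 / 200)
    (p : EuclideanSpace ℝ (Fin 3)) (hp : ‖p‖ = 1) : ∃ x ∈ X, (11 / 16 : ℝ) ≤ ⟪x, p⟫ := by
  have hT := Cap.bondToCap_holds X B hX1 hcard hsepX hB hBcard hdeg hnb
  have h0 : (0 : EuclideanSpace ℝ (Fin 3)) ∈ interior (convexHull ℝ (X : Set (EuclideanSpace ℝ (Fin 3)))) :=
    Cap.zero_mem_interior_convexHull_of_twelve_le_card hT hX1 hcard.ge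
      (ca := 1 - 1 / (2 * (101 / 100 : ℝ) ^ 2)) (by norm_num) hsepX
  have hne : (facetNormals X).Nonempty := facetNormals_nonempty h0
  obtain ⟨c, hcF, hpc⟩ := exists_mem_argmaxCone (facetNormals X) hne p
  rw [argmaxCone_facetNormals_eq h0 hcF] at hpc
  obtain ⟨t, ht, q, hq, hpq⟩ := hpc
  have hcq : ⟪c, q⟫ = 1 := inner_eq_one_of_mem_convexHull_tightSet hq
  have hlevel := facet_level_bound hT hX1 hcard hsepX hB hBcard hdeg c hcF
  have hc0 : c ≠ 0 := ne_zero_of_mem_facetNormals hX1 hcF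
  have hcn : 0 < ‖c‖ := norm_pos_iff.2 hc0
  -- `‖q‖ ≥ 1/‖c‖ ≥ 11/16`
  have hq1 : ‖c‖⁻¹ ≤ ‖q‖ := by
    rw [inv_le_iff_one_le_mul₀' hcn]
    have := real_inner_le_norm c q
    rw [hcq] at this
    exact this
  have hκ16 : (11 / 16 : ℝ) ≤ ‖c‖⁻¹ := by
    have h : (11 / 16 : ℝ) ^ 2 ≤ ‖c‖⁻¹ ^ 2 := le_trans (by norm_num) hlevel
    exact (pow_le_pow_iff_left₀ (by norm_num) (inv_nonneg.2 hcn.le) two_ne_zero).1 h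
  have hq2 : (11 / 16 : ℝ) ≤ ‖q‖ := le_trans hκ16 hq1
  -- a tight vertex `v` with `⟪v, q⟫ ≥ ‖q‖²` (maximum principle for the linear map `⟪q, ·⟫`)
  obtain ⟨v, hv, hvq⟩ := ((innerₛₗ ℝ q).convexOn convex_univ).exists_ge_of_mem_convexHull
    (Set.subset_univ _) hq
  rw [innerₛₗ_apply_apply, innerₛₗ_apply_apply, real_inner_self_eq_norm_sq] at hvq
  have hvX : v ∈ X := tightSet_subset X c (Finset.mem_coe.1 hv)
  refine ⟨v, hvX, ?_⟩
  -- `p = t q` with `t ‖q‖ = 1`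
  have htq : t * ‖q‖ = 1 := by
    have h := congrArg norm hpq
    rw [hp, norm_smul, Real.norm_eq_abs, abs_of_nonneg ht] at h
    exact h.symm
  rw [hpq, real_inner_smul_right, real_inner_comm]
  have h1 : t * ‖q‖ ^ 2 ≤ t * ⟪q, v⟫ := mul_le_mul_of_nonneg_left hvq ht
  have h2 : t * ‖q‖ ^ 2 = ‖q‖ := by rw [sq, ← mul_assoc, htq, one_mul]
  linarith

/-! ## Undoing the normalisation -/

/-- **Cover in the normalised twelve-point form**: `1 ≤ ‖z j‖ ≤ 1.01 min 1 (n j)`,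
`n j ≤ ‖z j‖`, `n j ≤ dist (z j) (z k)` (`j ≠ k`), soft link `4`-regular ⟹ every unit `p` has
`⟪z j, p⟫ ≥ (21/32) ‖z j‖` for some `j`. -/
theorem cover_of_twelve_unit {z : Fin 12 → EuclideanSpace ℝ (Fin 3)} {n : Fin 12 → ℝ}
    (g1 : ∀ j, 1 ≤ ‖z j‖) (g2 : ∀ j, ‖z j‖ ≤ (1 + 1 / 100) * min 1 (n j))
    (g3 : ∀ j, n j ≤ ‖z j‖) (g4 : ∀ j k, j ≠ k → n j ≤ dist (z j) (z k))
    (g5 : ∀ j, (Finset.univ.filter (fun k : Fin 12 =>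
      k ≠ j ∧ dist (z j) (z k) ≤ (1 + 1 / 100) * min (n j) (n k))).card = 4)
    (p : EuclideanSpace ℝ (Fin 3)) (hp : ‖p‖ = 1) : ∃ j, (21 / 32 : ℝ) * ‖z j‖ ≤ ⟪z j, p⟫ := by
  obtain ⟨X, B, hX1, hcard, hsepX, hB, hBcard, hdeg, hnb, hnear⟩ :=
    hull_setting_of_twelve (η := 1 / 100) (by norm_num) le_rfl g1 g2 g3 g4 g5
  obtain ⟨x, hx, hxp⟩ := hull_cover hX1 hcard hsepX hB hBcard hdeg hnb p hp
  obtain ⟨j, hj⟩ := hnear x hx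
  refine ⟨j, ?_⟩
  have h1 : ⟪z j, p⟫ = ⟪x, p⟫ + ⟪z j - x, p⟫ := by rw [inner_sub_left]; ring
  have h2 : |⟪z j - x, p⟫| ≤ ‖z j - x‖ * ‖p‖ := abs_real_inner_le_norm _ _
  rw [hp, mul_one, ← dist_eq_norm] at h2
  have h3 : ‖z j‖ ≤ 1 + 1 / 100 :=
    le_trans (g2 j) (mul_le_of_le_one_right (by norm_num) (min_le_left _ _))
  have h4 := (abs_le.1 h2).1
  linarith

/-- **`ShellHoleBound (21/32)` holds.** -/
theorem shellHoleBound_holds : OverbindingBudgetGapFreeShellHole.ShellHoleBound (21 / 32) := by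
  intro N y hy i hcf u
  -- enumerate the twelve bond-neighbours of `i` (as in `softFourRings_of_twelve`)
  set S : Set (Fin N) := (bondGraph (1 / 100 : ℝ) y).neighborSet i with hS
  have hfin : S.Finite := hcf.finite_neighborSet
  haveI : Finite S := hfin.to_subtype
  have hcardS : Nat.card S = 12 := by rw [Nat.card_coe_set_eq]; exact hcf.1
  set e : S ≃ Fin 12 := Finite.equivFinOfCardEq hcardS with he
  set idx : Fin 12 → Fin N := fun k => ((e.symm k : S) : Fin N) with hidx
  have hidx_mem : ∀ k, idx k ∈ S := fun k => (e.symm k).2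
  have hidx_inj : Function.Injective idx := Subtype.val_injective.comp e.symm.injective
  have hidx_e : ∀ (x : Fin N) (hx : x ∈ S), idx (e ⟨x, hx⟩) = x := fun x hx => by simp [hidx]
  have hne_i : ∀ k, i ≠ idx k := fun k => (mem_neighborSet_bondGraph.1 (hidx_mem k)).1
  have hadj : ∀ k, (bondGraph (1 / 100 : ℝ) y).Adj i (idx k) := fun k =>
    (SimpleGraph.mem_neighborSet _ _ _).1 (hidx_mem k)
  have h1 : ∀ k, nearestDist y i ≤ dist (y i) (y (idx k)) := fun k =>
    nearestDist_le_dist y (hne_i k).symm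
  have h2 : ∀ k, dist (y i) (y (idx k)) ≤
      (1 + 1 / 100) * min (nearestDist y i) (nearestDist y (idx k)) := fun k =>
    (mem_neighborSet_bondGraph.1 (hidx_mem k)).2
  have h3 : ∀ k, nearestDist y (idx k) ≤ dist (y (idx k)) (y i) := fun k =>
    nearestDist_le_dist y (hne_i k)
  have h4 : ∀ j k : Fin 12, j ≠ k → nearestDist y (idx j) ≤ dist (y (idx j)) (y (idx k)) :=
    fun j k hjk => nearestDist_le_dist y (fun h => hjk (hidx_inj h).symm)
  have h5 : ∀ j : Fin 12, (Finset.univ.filter (fun k : Fin 12 => k ≠ j ∧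
      dist (y (idx j)) (y (idx k)) ≤
        (1 + 1 / 100) * min (nearestDist y (idx j)) (nearestDist y (idx k)))).card = 4 := by
    intro j
    have hring : ringNumber (1 / 100 : ℝ) y i (idx j) = 4 := hcf.2 (idx j) (hidx_mem j)
    have himage : (bondGraph (1 / 100 : ℝ) y).neighborSet i ∩
        (bondGraph (1 / 100 : ℝ) y).neighborSet (idx j) =
        idx '' ((Finset.univ.filter (fun k : Fin 12 => k ≠ j ∧
          dist (y (idx j)) (y (idx k)) ≤
            (1 + 1 / 100) * min (nearestDist y (idx j)) (nearestDist y (idx k)))) :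
              Set (Fin 12)) := by
      ext x
      simp only [Set.mem_inter_iff, Set.mem_image, Finset.coe_filter, Finset.mem_univ, true_and,
        Set.mem_setOf_eq]
      constructor
      · rintro ⟨hxS, hxj⟩
        obtain ⟨hne, hdist⟩ := mem_neighborSet_bondGraph.1 hxj
        refine ⟨e ⟨x, hxS⟩, ⟨?_, ?_⟩, hidx_e x hxS⟩
        · intro heq
          apply hne
          rw [← hidx_e x hxS, heq]
        · rw [hidx_e x hxS]
          exact hdist
      · rintro ⟨k, ⟨hkj, hdist⟩, rfl⟩
        exact ⟨hidx_mem k, mem_neighborSet_bondGraph.2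
          ⟨fun h => hkj (hidx_inj h).symm, hdist⟩⟩
    rw [ringNumber_def, himage, Set.ncard_image_of_injective _ hidx_inj,
      Set.ncard_coe_finset] at hring
    exact hring
  -- the scale `s = nn_i` is positive (injectivity)
  set s := nearestDist y i with hs
  have hspos : 0 < s := by
    rcases (nearestDist_nonneg y i).eq_or_lt with h0 | hpos
    · exfalso
      have hle : dist (y i) (y (idx 0)) ≤ 0 := by
        refine le_trans (h2 0) ?_
        rw [hs, ← h0]
        have := min_le_left (0 : ℝ) (nearestDist y (idx 0))
        nlinarith
      exact hne_i 0 (hy (dist_le_zero.1 hle))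
    · exact hpos
  -- the degenerate direction
  by_cases hu : u = 0
  · refine ⟨idx 0, hadj 0, ?_⟩
    rw [hu, inner_zero_right, norm_zero, mul_zero, mul_zero]
  -- normalise: `z' j = s⁻¹ (y (idx j) − y i)`, `n' j = s⁻¹ nn_{idx j}`
  have hs' : 0 < s⁻¹ := inv_pos.2 hspos
  set z' : Fin 12 → EuclideanSpace ℝ (Fin 3) := fun j => s⁻¹ • (y (idx j) - y i) with hz'
  set n' : Fin 12 → ℝ := fun j => s⁻¹ * nearestDist y (idx j) with hn'
  have hnorm : ∀ j, ‖z' j‖ = s⁻¹ * dist (y (idx j)) (y i) := fun j => by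
    rw [hz', norm_smul, Real.norm_eq_abs, abs_of_pos hs', dist_eq_norm]
  have hdist : ∀ j k, dist (z' j) (z' k) = s⁻¹ * dist (y (idx j)) (y (idx k)) := fun j k => by
    rw [hz', dist_smul₀, Real.norm_eq_abs, abs_of_pos hs', dist_sub_right]
  have hmin : ∀ j k, min (n' j) (n' k) =
      s⁻¹ * min (nearestDist y (idx j)) (nearestDist y (idx k)) := fun j k => by
    rw [hn', mul_min_of_nonneg _ _ hs'.le]
  have g1 : ∀ j, 1 ≤ ‖z' j‖ := fun j => by
    rw [hnorm, dist_comm, le_inv_mul_iff₀ hspos, mul_one]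
    exact h1 j
  have g2 : ∀ j, ‖z' j‖ ≤ (1 + 1 / 100) * min 1 (n' j) := fun j => by
    have : min 1 (n' j) = s⁻¹ * min s (nearestDist y (idx j)) := by
      rw [hn', mul_min_of_nonneg _ _ hs'.le, inv_mul_cancel₀ hspos.ne']
    rw [hnorm, this, dist_comm, mul_left_comm]
    exact mul_le_mul_of_nonneg_left (h2 j) hs'.le
  have g3 : ∀ j, n' j ≤ ‖z' j‖ := fun j => by
    rw [hnorm, hn']
    exact mul_le_mul_of_nonneg_left (h3 j) hs'.le
  have g4 : ∀ j k, j ≠ k → n' j ≤ dist (z' j) (z' k) := fun j k hjk => by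
    rw [hdist, hn']
    exact mul_le_mul_of_nonneg_left (h4 j k hjk) hs'.le
  have g5 : ∀ j, (Finset.univ.filter (fun k : Fin 12 =>
      k ≠ j ∧ dist (z' j) (z' k) ≤ (1 + 1 / 100) * min (n' j) (n' k))).card = 4 := fun j => by
    rw [← h5 j]
    congr 1
    refine Finset.filter_congr fun k _ => ?_
    rw [hdist, hmin, mul_left_comm, mul_le_mul_iff_right₀ hs']
  -- the unit direction
  have hun : 0 < ‖u‖ := norm_pos_iff.2 hu
  set p : EuclideanSpace ℝ (Fin 3) := ‖u‖⁻¹ • u with hpdef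
  have hp : ‖p‖ = 1 := by
    rw [hpdef, norm_smul, norm_inv, norm_norm, inv_mul_cancel₀ hun.ne']
  obtain ⟨j, hj⟩ := cover_of_twelve_unit g1 g2 g3 g4 g5 p hp
  refine ⟨idx j, hadj j, ?_⟩
  have hzj : y (idx j) - y i = s • z' j := by
    rw [hz', smul_smul, mul_inv_cancel₀ hspos.ne', one_smul]
  have hpj : ⟪z' j, p⟫ = ‖u‖⁻¹ * ⟪z' j, u⟫ := by rw [hpdef, real_inner_smul_right]
  have hn1 : ‖y (idx j) - y i‖ = s * ‖z' j‖ := by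
    rw [hzj, norm_smul, Real.norm_eq_abs, abs_of_pos hspos]
  have hi1 : inner ℝ (y (idx j) - y i) u = s * ⟪z' j, u⟫ := by
    rw [hzj, real_inner_smul_left]
  rw [hn1, hi1]
  rw [hpj] at hj
  have hmul := mul_le_mul_of_nonneg_left hj (mul_nonneg hspos.le hun.le)
  have hsimp : s * ‖u‖ * (‖u‖⁻¹ * ⟪z' j, u⟫) = s * ⟪z' j, u⟫ := by
    field_simp
  rw [hsimp] at hmul
  linarith

/-- **`GapFreeShells` holds** (charge-free shells at one percent have no admissible
fourteenth site closer than `9/7` of the nearest-neighbour distance). -/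
theorem gapFreeShells_holds : OverbindingBudgetMisfitCensusStatements.GapFreeShells :=
  OverbindingBudgetGapFreeShellHole.gapFreeShells_of_shellHoleBound_fortyNine shellHoleBound_holds

end Summit.AtomisticToContinuum.Crystallization.Theorems.OverbindingBudgetShellHoleCover
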